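import Summits.BirchSwinnertonDyer.BirchSwinnertonDyer.Theorems.ResidualThetaTransportAtTwoThetaLayerLambdaCongruenceAtTwoCuspSpanArtinWitness
import Summits.BirchSwinnertonDyer.BirchSwinnertonDyer.Theorems.ResidualThetaTransportAtTwoThetaLayerLambdaCongruenceAtTwoCuspSpanArtinArithmetic
import Summits.BirchSwinnertonDyer.BirchSwinnertonDyer.Theorems.ResidualThetaTransportAtTwoThetaLayerLambdaCongruenceAtTwoGlue
import HarnessLib

/-!
# Route `ResidualThetaTransportAtTwo`, node (G′)_N = `CuspSpanEvenAtTwo N` (item 27436; cruxes Kan⁺ 20688 / Kμ⁺ 20689 / 21437):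
# the node at EVERY odd level from ARTIN'S PRIMITIVE-ROOT CONJECTURE FOR THE BASE 2 IN PROGRESSIONS `≡ 3 (mod 8)`
# (Hooley 1967 / Lenstra 1977 / Moree 1999: a theorem under GRH)

Cell `bsd-wall`, extra width seat `bsd-wall-rtt-p3-w5` g0 (2026-08-28). THEOREMS ONLY (no `def`, no `sorry`, no named fact); helper
`--supports stmt-BirchSwinnertonDyer-20688`; BSD is not proved by this. This completes the seat's check of
`Cruxes/ThetaLayerLambdaCongruenceAtTwo/Lines/birth-generation.md` §4.2 (lead g9: «(G′)_N for all odd N under GRH — sketch, to be checked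
line by line by the next seat»). VERDICT: the sketch is correct; its two open bookkeeping points settle uniformly —
(ii) the quadratic obstruction `(a/q) = +1` is removed for EVERY element by ONE left parabolic move `a ↦ a_j = a + jNc'` with
`|a_j| ≡ 3 (mod 4)` (always possible, `j → ±∞`) together with the SIGN of the class `±c' (mod a_j)` (`…CuspSpanArtinArithmetic`,
`jacobiSym_eq_one_of_progression`); (iii) `gcd((q−1)/2, φ(N)) = 1` is arranged by choosing `j` with `gcd(a_j, φ(N)) = 1` and
`q ≡ 2 (mod ℓ)` for the odd primes `ℓ ∣ φ(N)`, `q ≡ 3 (mod 8)`; and only the classes `d ≡ 1 (mod N)` need killing (`…CuspSpanArtinWitness`).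

THE HYPOTHESIS (inline, never asserted):
  (AP₃)  for all `M, r, B` with `8 ∣ M`, `r ≡ 3 (mod 8)`, `gcd(r, M) = 1` there is a prime `q > B`, `q ≡ r (mod M)`, with `2` a primitive
         root mod `q` («every non-zero residue is a power of `2`»; `…_of_artin_orderOf` takes `orderOf (2 : ZMod q) = q − 1`).
(AP₃) is Artin's conjecture for `g = 2` on progressions `r ≡ ±3 (mod 8)`: under GRH for the Dedekind zeta functions of the fields
`ℚ(ζ_M, ζ_n, 2^{1/n})` it holds with density `2A(r,M,1)/φ(M) > 0` (Moree 1999 Thm. 2 with `h = 1`, `Δ = 8`, `b = 1`; Lenstra 1977 (8.3);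
vanishing criterion Moree Thm. 4: `δ(r,M,2) = 0` iff `8 ∣ M ∧ (2/r) = 1`, excluded by `r ≡ 3 (mod 8)`). Unconditionally OPEN.

* §1 `ArtinRoute.witnesses_of_artin` — (AP₃) ⟹ for odd `N`, `a ≡ 1 (mod N)`, `c' ≠ 0`, `gcd(a, Nc') = 1`: ∃ `j, t ∈ ℤ`, `k ≥ 1` with
  `N(c' + t(a + jNc')) ∣ (a + jNc')4^k − 1`. Construction: `a₁ = a + j₁Nc'` prime to `2φ(N)`; `a_f = a₁ ± 4X`, `X = |φ(N)Nc'|(|a₁|+1)`, the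
  sign making `|a_f| ≡ 3 (mod 4)`; `σ = −sgn(a_f)(c'/|a_f|)`; `r ≡ 3 (8)`, `r ≡ σc' (|a_f|)`, `r ≡ 2 (odd ℓ ∣ φ(N))` (CRT); the prime `q` of
  (AP₃); `(a_f/q) = 1`, so `a_f ≡ 4^i (mod q)`; `k ≡ 0 (φ(N))`, `k ≡ −i ((q−1)/2)` (CRT, the moduli being coprime); `Nq ∣ a_f4^k − 1`;
  `t = (σq − c')/a_f`.
* §2 `cuspSpanEvenAtTwo_of_artin` (+ `_orderOf`, `forall_…`) — (AP₃) ⟹ `CuspSpanEvenAtTwo N` for every odd `N`; BY NAME the route item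
  27436 `CuspSpanEvenAtTwoOdd` conditionally on (AP₃) (`cuspSpanEvenAtTwoOdd_of_artin`), hence Kan⁺ `ThetaLayerLambdaCongruenceAtTwo` from
  the PUB⁵ bundle `PublishedInputsHeckeAtTwo` and (AP₃) through the landed glue 27454 (`thetaLayerLambdaCongruenceAtTwo_of_pub_of_artin`).

WHAT THIS MEANS AND DOES NOT MEAN. The node — hence, modulo the print binders, FLAT / item 21437 / Kan⁺ 20688 / Kμ⁺ 20689 / TP2 K1 — is
reduced to ONE classical conjecture, true under GRH. Nothing is asserted: (AP₃) is a hypothesis; no item is closed; BSD is not proved by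
any of this. CAVEAT FOR THE VET: the same mechanism for an odd base `p` (classes `|d| = p^k`) would reduce Greenberg–Iwasawa `μ = 0`
statements to Artin's conjecture for `p` in progressions — strong enough that the whole chain (G′)_N ⟹ FLAT (rtt-p4 lineage) and this file
deserve an independent refuter pass.

References: C. Hooley, J. reine angew. Math. 225 (1967) 209–220 [Hooley1967]; H. W. Lenstra, Invent. Math. 42 (1977) 201–224, Thm. (8.3)
[Lenstra1977]; P. Moree, J. Number Theory 78 (1999) 85–98, Thm. 2, Thm. 4 [Moree1999]; P. Moree, Integers 12 (2012), survey [Moree2012];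
H. Rademacher, Abh. Math. Sem. Hamburg 7 (1929) [Rademacher1929]; R. Pollack, Duke Math. J. 118 (2003) Conj. 6.3 [Pollack2003].
-/

set_option autoImplicit false
set_option linter.dupNamespace false

noncomputable section

open scoped BigOperators NumberTheorySymbols MatrixGroups

open CongruenceSubgroup

namespace Summit.BirchSwinnertonDyer.BirchSwinnertonDyer.Theorems.SignedMuAtTwo

/-! ## §1. From Artin primes in progressions to the divisor witnesses -/

namespace ArtinRoute

/-- **(AP₃) ⟹ DIVISOR WITNESSES at every odd level.** Assume Artin primes for the base `2` in every progression `r (mod M)` with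
`8 ∣ M`, `r ≡ 3 (mod 8)`, `gcd(r, M) = 1` (hypothesis `hAP`, «every non-zero residue mod `q` is a power of `2`»). Then for odd `N` and
integers `a ≡ 1 (mod N)`, `c' ≠ 0` with `gcd(a, Nc') = 1` there are `j, t ∈ ℤ` and `k ≥ 1` with `N·(c' + t(a + jNc')) ∣ (a + jNc')·4^k − 1`.
Construction: `a₁ = a + j₁Nc'` prime to `2φ(N)`; `a_f = a₁ ± 4X` with `|a_f| ≡ 3 (mod 4)`; `σ = −sgn(a_f)(c'/|a_f|)`; `r ≡ 3 (mod 8)`,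
`r ≡ σc' (mod |a_f|)`, `r ≡ 2 (mod ℓ)` for odd primes `ℓ ∣ φ(N)`; `q` the Artin prime; `(a_f/q) = 1` so `a_f ≡ 4^i (mod q)`; `k ≡ 0 (mod φ(N))`,
`k ≡ −i (mod (q−1)/2)`; `t = (σq − c')/a_f`. [cite: Lenstra1977, Thm. (8.3)] [cite: Moree1999, Thm. 2 and Thm. 4] [cite: Hooley1967, Thm.] -/
theorem witnesses_of_artin
    (hAP : ∀ (M r B : ℕ), 8 ∣ M → r % 8 = 3 → Nat.Coprime r M →
      ∃ q : ℕ, q.Prime ∧ B < q ∧ q ≡ r [MOD M] ∧ ∀ x : ZMod q, x ≠ 0 → ∃ i : ℕ, (2 : ZMod q) ^ i = x)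
    {N : ℕ} (hN : Odd N) (a c' : ℤ) (hcop : IsCoprime a ((N : ℤ) * c')) (ha1 : (N : ℤ) ∣ a - 1)
    (hc0 : c' ≠ 0) :
    ∃ j t : ℤ, ∃ k : ℕ, 1 ≤ k ∧ (N : ℤ) * (c' + t * (a + j * N * c')) ∣ (a + j * N * c') * 4 ^ k - 1 := by
  classical
  have hN2 : N % 2 = 1 := Nat.odd_iff.mp hN
  have hN0 : N ≠ 0 := by omega
  haveI : NeZero N := ⟨hN0⟩
  set n : ℕ := Nat.totient N with hn
  have hn0 : 0 < n := Nat.totient_pos.mpr (Nat.pos_of_ne_zero hN0)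
  set u : ℤ := (N : ℤ) * c' with hu
  have hu0 : u ≠ 0 := mul_ne_zero (by exact_mod_cast hN0) hc0
  -- Step 1: a translate `a₁ = a + j₁ u` prime to `2n`
  obtain ⟨j₁, hj₁⟩ := exists_isCoprime_add_mul hcop (2 * n) (by omega)
  set a₁ : ℤ := a + j₁ * u with ha₁
  have ha₁odd : a₁ % 2 = 1 := by
    have h2 : ¬ (2 : ℤ) ∣ a₁ := by
      intro h2
      have hunit := hj₁.isUnit_of_dvd' h2 ⟨(n : ℤ), by push_cast; ring⟩
      rw [Int.isUnit_iff] at hunit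
      omega
    exact Int.two_dvd_ne_zero.mp h2
  /- Step 2: the shift by a large multiple of `4 n u`, with sign chosen so that `|a_f| ≡ 3 (mod 4)` -/
  set V : ℤ := (n : ℤ) * u with hV
  have hV0 : V ≠ 0 := mul_ne_zero (by exact_mod_cast hn0.ne') hu0
  set w₀ : ℤ := (a₁.natAbs : ℤ) + 1 with hw₀
  set X : ℤ := (V.natAbs : ℤ) * w₀ with hX
  have hw₀pos : 0 < w₀ := by positivity
  have hXge : w₀ ≤ X := by
    have h1 : (1 : ℤ) ≤ (V.natAbs : ℤ) := by exact_mod_cast Int.natAbs_pos.mpr hV0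
    exact le_mul_of_one_le_left hw₀pos.le h1
  set s₀ : ℤ := if a₁ % 4 = 3 then 1 else -1 with hs₀
  set af : ℤ := a₁ + s₀ * (4 * X) with haf
  set j : ℤ := j₁ + s₀ * 4 * w₀ * V.sign * n with hj
  have hVabs : (V.natAbs : ℤ) = V.sign * V := (Int.sign_mul_self_eq_natAbs V).symm
  have haf_eq : af = a + j * N * c' := by
    rw [haf, hX, hVabs, hj, ha₁, hV, hu]
    ring
  have ha₁le : a₁ ≤ (a₁.natAbs : ℤ) := Int.le_natAbs
  have ha₁ge : -(a₁.natAbs : ℤ) ≤ a₁ := by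
    have h1 : -a₁ ≤ ((-a₁).natAbs : ℤ) := Int.le_natAbs
    rw [Int.natAbs_neg] at h1
    omega
  have hkey : (0 < af ∧ af % 4 = 3) ∨ (af < 0 ∧ af % 4 = 1) := by
    by_cases h3 : a₁ % 4 = 3
    · have hs : s₀ = 1 := by rw [hs₀, if_pos h3]
      left
      have e : af = a₁ + 4 * X := by rw [haf, hs]; ring
      constructor <;> omega
    · have hs : s₀ = -1 := by rw [hs₀, if_neg h3]
      right
      have e : af = a₁ - 4 * X := by rw [haf, hs]; ring
      constructor <;> omega
  have haf0 : af ≠ 0 := by rcases hkey with ⟨h, _⟩ | ⟨h, _⟩ <;> omega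
  -- coprimality of `af` with `2n` and with `c'`; `af ≡ 1 (mod N)`
  have hafcop : IsCoprime af (2 * (n : ℤ)) := by
    have hVn : (V.natAbs : ℤ) = (n : ℤ) * (u.natAbs : ℤ) := by
      rw [hV, Int.natAbs_mul, Int.natAbs_natCast]; push_cast; ring
    have e : af = a₁ + (2 * (n : ℤ)) * (2 * s₀ * (u.natAbs : ℤ) * w₀) := by
      rw [haf, hX, hVn]; ring
    rw [e]
    exact hj₁.add_mul_left_left _
  have hafc : IsCoprime af c' := by
    have h1 : IsCoprime a c' := hcop.of_mul_right_right
    rw [haf_eq, show a + j * N * c' = a + (j * N) * c' by ring]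
    exact h1.add_mul_right_left _
  have hafN : (N : ℤ) ∣ af - 1 := by
    rw [haf_eq, show a + j * N * c' - 1 = (a - 1) + N * (j * c') by ring]
    exact dvd_add ha1 (dvd_mul_right _ _)
  /- Step 3: `A = |af|`, the signs `s`, `σ`, the odd radical `R` of `n`, the residue `r` -/
  set A : ℕ := af.natAbs with hA
  have hA4 : A % 4 = 3 := by
    rcases hkey with ⟨hpos, hmod⟩ | ⟨hneg, hmod⟩
    · have : (A : ℤ) = af := by rw [hA]; exact Int.natAbs_of_nonneg hpos.le
      omega
    · have : (A : ℤ) = -af := by rw [hA]; exact Int.ofNat_natAbs_of_nonpos hneg.le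
      omega
  have hAodd : Odd A := Nat.odd_iff.mpr (by omega)
  have hA0 : A ≠ 0 := by omega
  set s : ℤ := af.sign with hsdef
  have hs : s = 1 ∨ s = -1 := by
    rcases hkey with ⟨hpos, _⟩ | ⟨hneg, _⟩
    · left; rw [hsdef]; exact Int.sign_eq_one_of_pos hpos
    · right; rw [hsdef]; exact Int.sign_eq_neg_one_of_neg hneg
  have hafS : af = s * A := by rw [hsdef, hA]; exact (Int.sign_mul_natAbs af).symm
  have hs2 : s * s = 1 := by rcases hs with h | h <;> rw [h] <;> norm_num
  have hAs : (A : ℤ) = s * af := by rw [hafS, ← mul_assoc, hs2, one_mul]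
  have hAn : Nat.Coprime A n := by
    have h1 : IsCoprime af (n : ℤ) := hafcop.of_mul_right_right
    rw [Int.isCoprime_iff_gcd_eq_one, Int.gcd_eq_natAbs, Int.natAbs_natCast] at h1
    exact h1
  have hcA : c'.gcd A = 1 := by
    have h1 := hafc.symm
    rw [Int.isCoprime_iff_gcd_eq_one] at h1
    rw [← h1, Int.gcd_eq_natAbs, Int.gcd_eq_natAbs, Int.natAbs_natCast]
  have hcA' : IsCoprime c' (A : ℤ) := by
    rw [hAs, show s * af = af * s by ring]
    refine hafc.symm.mul_right ?_
    rcases hs with h | h <;> rw [h]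
    · exact isCoprime_one_right
    · exact isCoprime_one_right.neg_right
  set σ : ℤ := -s * J(c' | A) with hσ
  have hJc : J(c' | A) = 1 ∨ J(c' | A) = -1 := jacobiSym.eq_one_or_neg_one hcA
  have hσ1 : σ = 1 ∨ σ = -1 := by
    rcases hs with h | h <;> rcases hJc with h' | h' <;> simp [hσ, h, h']
  have hσ2 : σ * σ = 1 := by rcases hσ1 with h | h <;> rw [h] <;> norm_num
  have hσc : IsCoprime (σ * c') (A : ℤ) := by
    refine IsCoprime.mul_left ?_ hcA'
    rcases hσ1 with h | h <;> rw [h]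
    · exact isCoprime_one_left
    · exact isCoprime_one_left.neg_left
  set R : ℕ := ∏ p ∈ n.primeFactors.filter (· ≠ 2), p with hR
  have hRdvd : R ∣ n :=
    (Finset.prod_dvd_prod_of_subset _ _ _ (Finset.filter_subset _ _)).trans (Nat.prod_primeFactors_dvd n)
  have hR2 : ¬ 2 ∣ R := by
    intro h2
    obtain ⟨p, hp, h2p⟩ := (Nat.prime_two.prime.dvd_finsetProd_iff _).mp h2
    have hpP : p.Prime := Nat.prime_of_mem_primeFactors (Finset.mem_filter.mp hp).1
    have : 2 = p := (Nat.prime_dvd_prime_iff_eq Nat.prime_two hpP).mp h2p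
    exact (Finset.mem_filter.mp hp).2 this.symm
  have hRodd : Odd R := Nat.odd_iff.mpr (Nat.two_dvd_ne_zero.mp hR2)
  have hR0 : R ≠ 0 := by intro h; rw [h] at hR2; exact hR2 (dvd_zero 2)
  have hAR : Nat.Coprime A R := hAn.coprime_dvd_right hRdvd
  have h8A : Nat.Coprime 8 A := by
    simpa using (Nat.coprime_two_left.mpr hAodd).pow_left 3
  have h8R : Nat.Coprime 8 R := by
    simpa using (Nat.coprime_two_left.mpr hRodd).pow_left 3
  have h8AR : Nat.Coprime (8 * A) R := Nat.Coprime.mul_left h8R hAR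
  set rA : ℕ := ((σ * c') % (A : ℤ)).toNat with hrA
  have hrA_cast : (rA : ℤ) = (σ * c') % (A : ℤ) :=
    Int.toNat_of_nonneg (Int.emod_nonneg _ (by exact_mod_cast hA0))
  have hrA_cop : Nat.Coprime rA A := by
    have e : (rA : ℤ) = σ * c' + (A : ℤ) * (-((σ * c') / (A : ℤ))) := by
      have h0 := Int.emod_def (σ * c') (A : ℤ)
      rw [hrA_cast]
      linear_combination h0
    have h1 : IsCoprime (rA : ℤ) (A : ℤ) := by rw [e]; exact hσc.add_mul_left_left _
    rw [Int.isCoprime_iff_gcd_eq_one, Int.gcd_natCast_natCast] at h1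
    exact h1
  obtain ⟨r₁, hr₁8, hr₁A⟩ := Nat.chineseRemainder h8A 3 rA
  obtain ⟨r, hr8A, hrR⟩ := Nat.chineseRemainder h8AR r₁ 2
  have hr8 : r ≡ 3 [MOD 8] := (hr8A.of_mul_right A).trans hr₁8
  have hrA' : r ≡ rA [MOD A] := (hr8A.of_mul_left 8).trans hr₁A
  set M : ℕ := 8 * A * R with hM
  have hM8 : 8 ∣ M := ⟨A * R, by rw [hM]; ring⟩
  have hMA : A ∣ M := ⟨8 * R, by rw [hM]; ring⟩
  have hMR : R ∣ M := ⟨8 * A, by rw [hM]; ring⟩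
  have hr8' : r % 8 = 3 := hr8
  have hrM : Nat.Coprime r M := by
    have c8 : Nat.Coprime r 8 := by rw [Nat.Coprime, hr8.gcd_eq]; norm_num
    have cA : Nat.Coprime r A := by rw [Nat.Coprime, hrA'.gcd_eq]; exact hrA_cop
    have cR : Nat.Coprime r R := by
      rw [Nat.Coprime, hrR.gcd_eq]
      exact Nat.coprime_two_left.mpr hRodd
    rw [hM]
    exact (c8.mul_right cA).mul_right cR
  /- Step 4: the Artin prime -/
  obtain ⟨q, hq, hqN, hqr, hgen⟩ := hAP M r N hM8 hr8' hrM
  haveI : Fact q.Prime := ⟨hq⟩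
  have hq8 : q % 8 = 3 := by
    have h1 : q ≡ r [MOD 8] := hqr.of_dvd hM8
    unfold Nat.ModEq at h1
    omega
  have hq4 : q % 4 = 3 := by omega
  have hq2 : q % 2 = 1 := by omega
  have hq3 : 3 ≤ q := by have := hq.two_le; omega
  have hqA : (q : ℤ) ≡ σ * c' [ZMOD A] := by
    have h1 : q ≡ rA [MOD A] := (hqr.of_dvd hMA).trans hrA'
    have h2 : (q : ℤ) ≡ (rA : ℤ) [ZMOD A] := Int.natCast_modEq_iff.mpr h1
    rw [hrA_cast] at h2
    exact h2.trans (Int.mod_modEq _ _)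
  -- `gcd(n, (q-1)/2) = 1`
  set h : ℕ := (q - 1) / 2 with hh
  have hh0 : 0 < h := by omega
  have hqh : q - 1 = 2 * h := by omega
  have hcop_nh : Nat.Coprime n h := by
    refine Nat.coprime_of_dvd fun p hp hpn hph ↦ ?_
    by_cases hp2 : p = 2
    · subst hp2
      omega
    · have hpR : p ∣ R := by
        apply Finset.dvd_prod_of_mem
        exact Finset.mem_filter.mpr ⟨Nat.mem_primeFactors.mpr ⟨hp, hpn, hn0.ne'⟩, hp2⟩
      have hq2p : q ≡ 2 [MOD p] := ((hqr.of_dvd hMR).trans hrR).of_dvd hpR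
      have hq1p : 1 ≡ q [MOD p] :=
        (Nat.modEq_iff_dvd' (by omega)).mpr (by rw [hqh]; exact dvd_mul_of_dvd_right hph 2)
      have h12 : 1 ≡ 2 [MOD p] := hq1p.trans hq2p
      have : p ∣ 2 - 1 := (Nat.modEq_iff_dvd' (by norm_num)).mp h12
      have : p = 1 := Nat.dvd_one.mp this
      exact hp.one_lt.ne' this
  /- Step 5: `af` is a power of `4` modulo `q`; the exponent `k` -/
  have hqA_cop : IsCoprime (q : ℤ) (A : ℤ) := by
    obtain ⟨z, hz⟩ := Int.modEq_iff_dvd.mp hqA.symm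
    -- hz : q - σ c' = A * z  ⟹ q = σ c' + A z
    have e : (q : ℤ) = σ * c' + (A : ℤ) * z := by linear_combination hz
    rw [e]
    exact hσc.add_mul_left_left z
  have haf_q : ((af : ℤ) : ZMod q) ≠ 0 := by
    intro h0
    have hdvd : (q : ℤ) ∣ af := (ZMod.intCast_zmod_eq_zero_iff_dvd af q).mp h0
    have hdvdA : (q : ℤ) ∣ (A : ℤ) := by rw [hA, Int.natCast_natAbs]; exact (dvd_abs _ _).mpr hdvd
    have hunit := hqA_cop.isUnit_of_dvd' (dvd_refl _) hdvdA
    rw [Int.isUnit_iff_natAbs_eq, Int.natAbs_natCast] at hunit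
    exact hq.one_lt.ne' hunit
  have hJ : J(af | q) = 1 := by
    rw [hafS]
    refine jacobiSym_eq_one_of_progression hA4 hq4 hs hcA ?_
    have e : -s * jacobiSym c' A * c' = σ * c' := by rw [hσ]
    rw [e]
    exact hqA
  have hsq : IsSquare ((af : ℤ) : ZMod q) := ZMod.isSquare_of_jacobiSym_eq_one hJ
  obtain ⟨i, hi⟩ := exists_pow_four_eq_of_isSquare hgen haf_q hsq
  have h4h : (4 : ZMod q) ^ h = 1 := four_pow_half_eq_one hq2
  obtain ⟨k₀, hk₀n, hk₀h⟩ := Nat.chineseRemainder hcop_nh 0 (h - i % h)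
  set k : ℕ := k₀ + n * h with hk
  have hnh : 0 < n * h := Nat.mul_pos hn0 hh0
  have hk1 : 1 ≤ k := by omega
  have hnk : n ∣ k := dvd_add (Nat.modEq_zero_iff_dvd.mp hk₀n) (dvd_mul_right n h)
  have hhik : h ∣ i + k := by
    have e0 := Nat.div_add_mod i h
    have hlt := Nat.mod_lt i hh0
    have e1 : i + (h - i % h) = h * (i / h + 1) := by rw [mul_add, mul_one]; omega
    have e2 : i + k₀ ≡ i + (h - i % h) [MOD h] := Nat.ModEq.add_left i hk₀h
    have e3 : h ∣ i + k₀ := by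
      have h0 : i + (h - i % h) ≡ 0 [MOD h] := by
        rw [e1]; exact Nat.modEq_zero_iff_dvd.mpr (dvd_mul_right h _)
      exact Nat.modEq_zero_iff_dvd.mp (e2.trans h0)
    have e4 : i + k = (i + k₀) + n * h := by rw [hk]; ring
    rw [e4]
    exact dvd_add e3 (dvd_mul_left h n)
  have hdq : (q : ℤ) ∣ af * 4 ^ k - 1 := by
    refine (ZMod.intCast_zmod_eq_zero_iff_dvd _ q).mp ?_
    obtain ⟨t, ht⟩ := hhik
    push_cast
    rw [← hi, ← pow_add, ht, pow_mul, h4h, one_pow, sub_self]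
  have h4Ncop : Nat.Coprime 4 N := by
    simpa using (Nat.coprime_two_left.mpr hN).pow_left 2
  have h4n : (4 : ZMod N) ^ n = 1 := by
    have h1 : (ZMod.unitOfCoprime 4 h4Ncop) ^ n = 1 := ZMod.pow_totient _
    have h2 : (((ZMod.unitOfCoprime 4 h4Ncop) ^ n : (ZMod N)ˣ) : ZMod N) = 1 := by
      rw [h1, Units.val_one]
    rw [Units.val_pow_eq_pow_val, ZMod.coe_unitOfCoprime, Nat.cast_ofNat] at h2
    exact h2
  have hdN : (N : ℤ) ∣ af * 4 ^ k - 1 := by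
    refine (ZMod.intCast_zmod_eq_zero_iff_dvd _ N).mp ?_
    have haf1 : ((af : ℤ) : ZMod N) = 1 := by
      have h1 := (ZMod.intCast_eq_intCast_iff_dvd_sub 1 af N).mpr hafN
      rw [Int.cast_one] at h1
      exact h1.symm
    obtain ⟨t, ht⟩ := hnk
    push_cast
    rw [haf1, ht, pow_mul, h4n, one_pow, mul_one, sub_self]
  have hqN' : ¬ q ∣ N := fun hd ↦ absurd (Nat.le_of_dvd (Nat.pos_of_ne_zero hN0) hd) (not_le.mpr hqN)
  have hNq : IsCoprime (N : ℤ) (q : ℤ) := by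
    rw [Int.isCoprime_iff_gcd_eq_one, Int.gcd_natCast_natCast]
    exact Nat.coprime_comm.mp ((Nat.Prime.coprime_iff_not_dvd hq).mpr hqN')
  have hdNq : (N : ℤ) * q ∣ af * 4 ^ k - 1 := hNq.mul_dvd hdN hdq
  /- Step 6: the integer `t` -/
  obtain ⟨z, hz⟩ := Int.modEq_iff_dvd.mp hqA
  refine ⟨j, -σ * s * z, k, hk1, ?_⟩
  rw [← haf_eq]
  have ht : c' + (-σ * s * z) * af = σ * q := by
    have e1 : s * af * z = σ * c' - q := by rw [hz, hAs]
    linear_combination (-σ) * e1 - c' * hσ2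
  rw [ht]
  rcases hσ1 with h1 | h1
  · rw [h1, one_mul]; exact hdNq
  · rw [h1, neg_one_mul, mul_neg]; exact (neg_dvd).mpr hdNq

end ArtinRoute

/-! ## §2. The node at every odd level, and the closers by name -/

section Node

/-- **(AP₃) ⟹ (G′)_N at every odd level**: `CuspSpanEvenAtTwo N` for every odd `N`, from Artin's conjecture for `2` in progressions
`≡ 3 (mod 8)` (`ArtinRoute.witnesses_of_artin` + `cuspSpanEvenAtTwo_of_witnesses`). (AP₃) is a HYPOTHESIS (a theorem under GRH:
Hooley 1967, Lenstra 1977 Thm. (8.3), Moree 1999 Thm. 2/4); nothing is asserted. [cite: Lenstra1977, Thm. (8.3)] [cite: Moree1999, Thm. 2]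
[cite: Pollack2003, Conj. 6.3] -/
theorem cuspSpanEvenAtTwo_of_artin
    (hAP : ∀ (M r B : ℕ), 8 ∣ M → r % 8 = 3 → Nat.Coprime r M →
      ∃ q : ℕ, q.Prime ∧ B < q ∧ q ≡ r [MOD M] ∧ ∀ x : ZMod q, x ≠ 0 → ∃ i : ℕ, (2 : ZMod q) ^ i = x)
    (N : ℕ) [NeZero N] (hN : Odd N) : CuspSpanEvenAtTwo N :=
  cuspSpanEvenAtTwo_of_witnesses fun a c' hcop ha1 hc0 ↦ ArtinRoute.witnesses_of_artin hAP hN a c' hcop ha1 hc0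

/-- The same with «`2` is a primitive root mod `q`» spelled `orderOf (2 : ZMod q) = q − 1`. [cite: Lenstra1977, Thm. (8.3)]
[cite: Moree1999, Thm. 2] [cite: HardyWright2008, §9.6] -/
theorem cuspSpanEvenAtTwo_of_artin_orderOf
    (hAP : ∀ (M r B : ℕ), 8 ∣ M → r % 8 = 3 → Nat.Coprime r M →
      ∃ q : ℕ, q.Prime ∧ B < q ∧ q ≡ r [MOD M] ∧ orderOf (2 : ZMod q) = q - 1)
    (N : ℕ) [NeZero N] (hN : Odd N) : CuspSpanEvenAtTwo N := by
  refine cuspSpanEvenAtTwo_of_artin (fun M r B hM hr hrM ↦ ?_) N hN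
  obtain ⟨q, hq, hB, hqr, hroot⟩ := hAP M r B hM hr hrM
  exact ⟨q, hq, hB, hqr, ArtinRoute.exists_two_pow_eq_of_orderOf hq hroot⟩

/-- **(AP₃) ⟹ the node for ALL odd levels** (the binder of `flatMuZeroAtTwo_of_forall_cuspSpanEvenAtTwo` /
`signedMuAnalyticAtTwoPlus_of_abbesUllmo_of_forall_cuspSpanEvenAtTwo`). [cite: Lenstra1977, Thm. (8.3)] [cite: Pollack2003, Conj. 6.3] -/
theorem forall_cuspSpanEvenAtTwo_of_artin
    (hAP : ∀ (M r B : ℕ), 8 ∣ M → r % 8 = 3 → Nat.Coprime r M →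
      ∃ q : ℕ, q.Prime ∧ B < q ∧ q ≡ r [MOD M] ∧ ∀ x : ZMod q, x ≠ 0 → ∃ i : ℕ, (2 : ZMod q) ^ i = x) :
    ∀ (N : ℕ) [NeZero N], ¬ 2 ∣ N → CuspSpanEvenAtTwo N :=
  fun N _ h2 ↦ cuspSpanEvenAtTwo_of_artin hAP N (Nat.odd_iff.mpr (Nat.two_dvd_ne_zero.mp h2))

/-- **THE ROUTE ITEM 27436 `CuspSpanEvenAtTwoOdd` CONDITIONALLY ON (AP₃)** — the node of Kan⁺/Kμ⁺/21437/K1 BY NAME from Artin's conjecture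
for `2` in progressions `≡ 3 (mod 8)` (GRH-conditional in print). A conditional result: the item is NOT closed by this.
[cite: Lenstra1977, Thm. (8.3)] [cite: Moree1999, Thm. 2 and Thm. 4] [cite: Pollack2003, Conj. 6.3] -/
theorem cuspSpanEvenAtTwoOdd_of_artin
    (hAP : ∀ (M r B : ℕ), 8 ∣ M → r % 8 = 3 → Nat.Coprime r M →
      ∃ q : ℕ, q.Prime ∧ B < q ∧ q ≡ r [MOD M] ∧ ∀ x : ZMod q, x ≠ 0 → ∃ i : ℕ, (2 : ZMod q) ^ i = x) :
    Summit.BirchSwinnertonDyer.BirchSwinnertonDyer.Theses.ResidualThetaTransportAtTwo.CuspSpanEvenAtTwoOdd :=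
  fun N _ h2 ↦ (cuspSpanEvenAtTwo_iff N).mp (forall_cuspSpanEvenAtTwo_of_artin hAP N h2)

/-- **Kan⁺ `ThetaLayerLambdaCongruenceAtTwo` (crux 20688) from the PUB⁵ bundle and (AP₃)**, through the landed glue 27454
(`ThetaLayerLambdaCongruenceAtTwoGlue_proof`, w3 g6). Conditional on the print binders AND on (AP₃); nothing is closed by this.
[cite: Lenstra1977, Thm. (8.3)] [cite: Pollack2003, Conj. 6.3] -/
theorem thetaLayerLambdaCongruenceAtTwo_of_pub_of_artin
    (hPub : Summit.BirchSwinnertonDyer.BirchSwinnertonDyer.Theses.ResidualThetaTransportAtTwo.PublishedInputsHeckeAtTwo)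
    (hAP : ∀ (M r B : ℕ), 8 ∣ M → r % 8 = 3 → Nat.Coprime r M →
      ∃ q : ℕ, q.Prime ∧ B < q ∧ q ≡ r [MOD M] ∧ ∀ x : ZMod q, x ≠ 0 → ∃ i : ℕ, (2 : ZMod q) ^ i = x) :
    Summit.BirchSwinnertonDyer.BirchSwinnertonDyer.Theses.ResidualThetaTransportAtTwo.ThetaLayerLambdaCongruenceAtTwo :=
  Summit.BirchSwinnertonDyer.BirchSwinnertonDyer.Theorems.ThetaLayerLambdaCongruenceAtTwoGlue_proof hPub
    (cuspSpanEvenAtTwoOdd_of_artin hAP)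

end Node

end Summit.BirchSwinnertonDyer.BirchSwinnertonDyer.Theorems.SignedMuAtTwo

end
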